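import Literature.NumberTheory.Automorphic.GLnIntegralLeviUnipotent
import Literature.NumberTheory.Automorphic.UnitaryGroupSplitPlaceOrbitalIntegral
import HarnessLib

/-!
# [Rogawski1990 §4.9 Prop. 4.9.1 (b)] The unit fundamental lemma at a place SPLIT in `L`, `G`-regular classes in the Levi:
# `Φ^{G_v}(γ, 1_{K_v}) = c · |D_{G∕M}(p)|^{−1∕2} δ_P(p)^{1∕2} · Φ^{M}(p, 1_{K_M})` for `e γ = p ∈ M = GL₂ × GL₁ ≅ H_v`, `c` VISIBLE
(Rogawski (1990), §4.9 Prop. 4.9.1 (b) p. 55 «`Δ_{G∕H}(γ)Φ^κ(γ, f) = Φ^st(γ, f^H)` where `f` and `f^H` are the units of the Hecke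
algebras … (b) is proved in [BR₁]»; at a place `v` split in `E`: `G_v ≅ GL₃(E_w)` (Mok §1), `H_v ≅ GL₂ × GL₁` is a Levi subgroup,
`κ_v = +1` and stable conjugacy is conjugacy (★ `LocalStableConjSplitPlace`), so the lemma is parabolic descent, Lemma 4.13.1 (a) p. 70)

Topic `NumberTheory/Rogawski1990`; namespace `Literature.NumberTheory.Rogawski1990`. THEOREMS ONLY (no definition, no instance, no
named fact, no `sorry`). Cell `pub/hodgecm-mathlib`, programme P3a, letter **N7 (#103)** ★ `UnitFundamentalLemmaExplicitClosed` —
FIRST PAY-DOWN PIECE, the split-place clause CUT at (n7-i)+(n7-iii) (LEAD F0P3a-plan T6-111 «D-N7s»): the `G`-side unit orbital integral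
of `G′_v = U(J)(F_v)` at a `G`-regular `γ` whose `w`-component `e γ = p` (★ `localSplitEquiv`) lies in the Levi `M_{c′}`, transported
through ★ `UnitaryGroupSplitPlaceOrbitalIntegral` («D-S1d») to the FIXED quotient `GL_N(E_w) ⧸ T′`, `T′ = e(C(γ))`, and descended by ★
`GLnLeviOrbitalDescent` («D-S1c») to `M_{c′}`, where the constant term of `1_K` is `κ(K) μ_U(U(𝒪)) · 1_{K_M}` (★ `GLnIntegralLeviUnipotent`).
The `H`-side is stated DIRECTLY on `M_{c′}` (the letter compares numbers; the identification of the `H_v = U(Φ₂)_v × U(Φ₁)_v`-orbital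
integral with the `M`-orbital integral is a one-line transport along the frame's split iso, left to the floor-2 assembler).

* §0 `lintegral_descConj_quotientMeasure_eq_of_mulEquiv_of_eq` — ★ `lintegral_descConj_quotientMeasure_eq_of_mulEquiv` with a FREE target
  element `γ′ = e γ` (so that `γ′ = ↑p`, `p : P_{c′}`, is allowed).
* §1 **`exists_lintegral_orbital_indicator_eq_mul_levi_of_split`** (n7-i): for the GL-side data (closed `T′ ≤ M_{c′}`, Haar-type `ρ′` on `T′`,
  Haar `ν′` with `ν′(GL_N(𝒪_w)) = 1`, non-zero invariant Radon `μ_{G∕M}`, `μ_{M∕T′}`, Haar `κ` on `K`, `μ_U` on `U_{c′}`) there is ONE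
  `C ∈ (0, ∞)` — the constant of ★ «D-S1c» — with, for every `γ`, `p`, `ν` (`ν(K_v) = 1`), `ρ` (`(e|)_* ρ = ρ′`):
  `∫⁻_{G′_v ⧸ C(γ)} 1_{K_v}(y γ y⁻¹) d(ν∕ρ) = C ‖det(1 − K_p)‖_w⁻¹ ‖det K_p‖_w · κ(K) μ_U(U_{c′}(𝒪_w)) · ∫⁻_{M ⧸ T′} 1_{K_M}(m p m⁻¹) dμ_{M∕T′}`.
  With ★ `normAbs_det_boxAd_eq_one_of_mem_glInt` (`‖det K_p‖ = 1` on `P ∩ K`) and ★ D-S2 `finWeylRatio_eq_box_of_split`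
  (`D_{G∕H,v} = ‖det(1 − K)‖ ‖det K‖^{−1∕2}` in the `GL₂ × GL₁` box) this is print's «`D_{G∕H} Φ^{G} = c · Φ^{H}`» at a split place for the
  units of the Hecke algebras, `c = C κ(K) μ_U(U(𝒪))` VISIBLE.

GAPS NAMED (not claimed here): (g1) «D-S1c-canonical» `C = 1` for the canonical normalisations (chain-rule × Iwasawa constant); (g2) the
floor-2 junction with the letter's predicates (`IsLocalUnitTransfer` over `endoEmbLocal`∕`EndoMatches`, the frame `H_v = U(Φ₂)_v × U(Φ₁)_v`,
`τ_v` ★ `finExplicitDelta_eq_tau_mul_weyl_of_split`). The reindexing between ★ D-S2's box `u_w⁻¹ g_w` on `L_w²` and the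
`{c′ = false} × {c′ = true}` box used here is ★ `finWeylRatio_eq_boxAd_of_split` ∕ ★ `boxAd_leviEmbeddingP_eq_kronecker`
(`Rogawski1990/FinExplicitTransferFactorBoxReindex`, «D-S2r»). `G`-regular classes only (`det(1 − K_p) ≠ 0`); the singular pair is ★
`UnitaryGroupSplitPlaceSingularPair`; nothing is claimed at non-split places. GL-side `LocallyCompactSpace`∕`SecondCountableTopology`
are BINDERS (★ `UnitaryGroup.locallyCompactSpace_gl_adicCompletion` ∕ `secondCountableTopology_gl_adicCompletion`).
HC_CM is proved only modulo the printed citations until rung 0 closes; this file discharges none of them.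

## References
* J. D. Rogawski, *Automorphic Representations of Unitary Groups in Three Variables* (1990), §4.9 Prop. 4.9.1 (b) p. 55; §4.13 Lemma
  4.13.1 (a) and proof p. 70; §14.6 p. 242 [Rogawski1990].
* D. Blasius, J. D. Rogawski, *Fundamental lemmas for `U(3)` and related groups* (1992), Thm. 1 [BlasiusRogawski1992].
* C. P. Mok, *Endoscopic classification of representations of quasi-split unitary groups* (2015), §1 p. 5 [Mok2014].
* A. Deitmar, S. Echterhoff, *Principles of Harmonic Analysis*, 2nd ed. (2014), Thm. 1.5.3 [DeitmarEchterhoff2014].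
-/

set_option autoImplicit false

noncomputable section

open MeasureTheory Measure Set Filter Topology NumberField IsDedekindDomain Literature.MeasureTheory.Group
open scoped ENNReal NNReal Matrix MatrixGroups

namespace Literature.NumberTheory.Rogawski1990

open Literature.NumberTheory.Automorphic Literature.NumberTheory.Automorphic.UnitaryGroup
open Literature.NumberTheory.GaloisRepresentations.IsNonarchimedeanLocalField

/-! ## §0 The `[0, ∞]`-valued transport to a non-centraliser target, with a free target element -/

section Transport

variable {G G' : Type*} [Group G] [Group G'] [TopologicalSpace G] [TopologicalSpace G']
  [IsTopologicalGroup G] [IsTopologicalGroup G'] [LocallyCompactSpace G] [LocallyCompactSpace G']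
  [SecondCountableTopology G] [SecondCountableTopology G'] [T2Space G] [T2Space G']
  [MeasurableSpace G] [BorelSpace G] [MeasurableSpace G'] [BorelSpace G']
  (e : G ≃* G') (he : Continuous e) (hes : Continuous e.symm)
  (H : Subgroup G) [hH : IsClosed (H : Set G)] (H' : Subgroup G') [hH' : IsClosed (H' : Set G')]
  (hHH' : ∀ g, e g ∈ H' ↔ g ∈ H)
  [MeasurableSpace (G ⧸ H)] [BorelSpace (G ⧸ H)] [MeasurableSpace (G' ⧸ H')] [BorelSpace (G' ⧸ H')]
  (ρ : Measure H) [ρ.IsMulLeftInvariant] [IsFiniteMeasureOnCompacts ρ] [ρ.IsOpenPosMeasure]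
  [ρ.IsInvInvariant] [SFinite ρ]
  (ρ' : Measure H') [ρ'.IsMulLeftInvariant] [IsFiniteMeasureOnCompacts ρ'] [ρ'.IsOpenPosMeasure]
  [ρ'.IsInvInvariant] [SFinite ρ']
  (ν : Measure G) [IsHaarMeasure ν] [ν.IsMulRightInvariant]
  (ν' : Measure G') [IsHaarMeasure ν'] [ν'.IsMulRightInvariant]

/-- ★ `lintegral_descConj_quotientMeasure_eq_of_mulEquiv` with the target element `γ' = e γ` FREE (so that `γ'` may be a
structure projection such as `↑p`, `p : P_c`): `∫⁻_{G'/H'} F(y γ' y⁻¹) d(ν'/ρ') = ∫⁻_{G/H} F(e(x γ x⁻¹)) d(ν/ρ)`.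
[cite: DeitmarEchterhoff2014, Thm. 1.5.3] -/
theorem lintegral_descConj_quotientMeasure_eq_of_mulEquiv_of_eq
    (hρ' : ρ' = Measure.map (subgroupCongrHomeomorph e H H' hHH' he hes) ρ) (hν' : ν' = Measure.map e ν)
    {γ : G} {γ' : G'} (hγ : e γ = γ') (hHγ : ∀ g ∈ H, g * γ = γ * g) (hH'γ : ∀ g ∈ H', g * γ' = γ' * g)
    (F : G' → ℝ≥0∞) :
    ∫⁻ y, descConj γ' H' hH'γ F y ∂quotientMeasure H' ρ' hH' ν' =
      ∫⁻ x, descConj γ H hHγ (F ∘ e) x ∂quotientMeasure H ρ hH ν := by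
  subst hγ
  exact lintegral_descConj_quotientMeasure_eq_of_mulEquiv e he hes H H' hHH' ρ ρ' ν ν' hρ' hν' hHγ hH'γ F

end Transport

/-! ## §1 (n7-i) The `G`-side unit orbital integral at a split place, `G`-regular `γ` with `e γ ∈ M_{c′}` -/

section Split

variable {F E : Type} [Field F] [NumberField F] [Field E] [NumberField E] [Algebra F E]
  [Algebra.IsQuadraticExtension F E]
  (c : E ≃ₐ[F] E) (N : ℕ) (J : Matrix (Fin N) (Fin N) E) {v : HeightOneSpectrum (𝓞 F)}
  (hc : c ≠ 1) (hJ : (J.map c)ᵀ = J) (w : PlacesOver E v) (hw : c • w.1 ≠ w.1)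
  (hJw : IsUnit (placeForm J w.1)) {c' : Fin N → Bool}
  [MeasurableSpace (w.1.adicCompletion E)] [BorelSpace (w.1.adicCompletion E)]
  [MeasurableSpace («local» E c N J v)] [BorelSpace («local» E c N J v)]
  [MeasurableSpace (GL (Fin N) (w.1.adicCompletion E))] [BorelSpace (GL (Fin N) (w.1.adicCompletion E))]
  [LocallyCompactSpace (GL (Fin N) (w.1.adicCompletion E))] [SecondCountableTopology (GL (Fin N) (w.1.adicCompletion E))]
  -- the GL-side torus `T′ = e(C(γ))` inside `M_{c′}` and the measures on the fixed GL-side quotients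
  (T' : Subgroup (GL (Fin N) (w.1.adicCompletion E)))
  (hT' : IsClosed (T' : Set (GL (Fin N) (w.1.adicCompletion E)))) (hT'M : T' ≤ standardLeviGL (w.1.adicCompletion E) c')
  [MeasurableSpace (GL (Fin N) (w.1.adicCompletion E) ⧸ T')] [BorelSpace (GL (Fin N) (w.1.adicCompletion E) ⧸ T')]
  [MeasurableSpace (GL (Fin N) (w.1.adicCompletion E) ⧸ standardLeviGL (w.1.adicCompletion E) c')]
  [BorelSpace (GL (Fin N) (w.1.adicCompletion E) ⧸ standardLeviGL (w.1.adicCompletion E) c')]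
  [MeasurableSpace (↥(standardLeviGL (w.1.adicCompletion E) c') ⧸ T'.subgroupOf (standardLeviGL (w.1.adicCompletion E) c'))]
  [BorelSpace (↥(standardLeviGL (w.1.adicCompletion E) c') ⧸ T'.subgroupOf (standardLeviGL (w.1.adicCompletion E) c'))]
  (ρ' : Measure ↥T') [ρ'.IsMulLeftInvariant] [IsFiniteMeasureOnCompacts ρ'] [ρ'.IsOpenPosMeasure] [ρ'.IsInvInvariant]
  [SFinite ρ']
  (ν' : Measure (GL (Fin N) (w.1.adicCompletion E))) [IsHaarMeasure ν'] [ν'.IsMulRightInvariant]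
  (μGM : Measure (GL (Fin N) (w.1.adicCompletion E) ⧸ standardLeviGL (w.1.adicCompletion E) c'))
  [SMulInvariantMeasure (GL (Fin N) (w.1.adicCompletion E))
    (GL (Fin N) (w.1.adicCompletion E) ⧸ standardLeviGL (w.1.adicCompletion E) c') μGM] [IsFiniteMeasureOnCompacts μGM]
  (μMT : Measure (↥(standardLeviGL (w.1.adicCompletion E) c') ⧸ T'.subgroupOf (standardLeviGL (w.1.adicCompletion E) c')))
  [SMulInvariantMeasure ↥(standardLeviGL (w.1.adicCompletion E) c')
    (↥(standardLeviGL (w.1.adicCompletion E) c') ⧸ T'.subgroupOf (standardLeviGL (w.1.adicCompletion E) c')) μMT]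
  [IsFiniteMeasureOnCompacts μMT]
  (κ : Measure ↥(glInt N (w.1.adicCompletion E))) [IsHaarMeasure κ]
  (μU : Measure ↥(unipotentRadicalGL (w.1.adicCompletion E) c')) [IsHaarMeasure μU] [SFinite μU]

include hT' hT'M in
/-- **(n7-i) The unit orbital integral of `U(J)(F_v)` at a split place, for a `G`-regular `γ` whose `w`-component `e γ = p`
lies in the Levi subgroup `M_{c′} ≅ H_v`, IS `|D_{G∕M}(p)|^{−1∕2} δ_P(p)^{1∕2}` times the unit orbital integral of `M`** — up
to ONE visible constant.  Fix the GL-side data: a closed `T′ ≤ M_{c′}` (the torus `e(C(γ))`), a Haar-type `ρ′` on `T′`, a Haar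
measure `ν′` on `GL_N(E_w)` with `ν′(GL_N(𝒪_w)) = 1`, non-zero invariant Radon measures `μ_{G∕M}` on `GL_N ⧸ M_{c′}` and `μ_{M∕T′}`
on `M_{c′} ⧸ T′`, Haar measures `κ` on `K = GL_N(𝒪_w)` and `μ_U` on `U_{c′}`.  There is ONE `C ∈ (0, ∞)` — the constant of ★
`exists_lintegral_descConj_eq_mul_lintegral_levi` («D-S1c») for `(ν′∕ρ′, μ_{G∕M}, μ_{M∕T′}, κ, μ_U)` — such that for EVERY
`γ ∈ U(J)(F_v)` with `e γ = p ∈ M_{c′}` centralised by `T′ = e(C(γ))`, `det(1 − K_p) ≠ 0` (print's `G`-regularity relative to `M`),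
every Haar `ν` on `U(J)(F_v)` with `ν(U(J)(𝒪_v)) = 1` and Haar `ρ` on `C(γ)` with `(e|)_* ρ = ρ′`:
`∫⁻_{U(J)_v ⧸ C(γ)} 1_{U(J)(𝒪_v)}(y γ y⁻¹) d(ν∕ρ) = C · ‖det(1 − K_p)‖_w⁻¹ ‖det K_p‖_w · (κ(K) μ_U(U_{c′}(𝒪_w))) · ∫⁻_{M ⧸ T′} 1_{K_M}(m p m⁻¹) dμ_{M∕T′}`
— i.e. `Φ^{G_v}(γ, 1_{K_v}) = c · |D_{G∕M}(p)|^{−1∕2} δ_P(p)^{1∕2} Φ^{M}(p, 1_{K_M})` with `c` VISIBLE (★ D-S1d `map_localSplitEquiv_eq` ∕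
`indicator_glInt_comp_localSplitEquiv`, §0, ★ D-S1c, §1).  The value `C = 1` for canonical data («D-S1c-canonical») and the junction with
the letter ★ `UnitFundamentalLemmaExplicitClosed` (frame `H_v = U(Φ₂)_v × U(Φ₁)_v`, `Δ‴_v`, `κ_v = +1`) are NOT claimed here.
[cite: Rogawski1990, §4.9 Prop. 4.9.1 (b) p. 55] [cite: Rogawski1990, §4.13, Lemma 4.13.1 (a), proof p. 70] [cite: Mok2014, §1 Notation p. 5] -/
theorem exists_lintegral_orbital_indicator_eq_mul_levi_of_split (hc' : Monotone c')
    (hJi : hJw.unit ∈ glInt N (w.1.adicCompletion E)) (hν' : ν' (glInt N (w.1.adicCompletion E)) = 1) (hGM : μGM ≠ 0)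
    (hMT : μMT ≠ 0) :
    ∃ C : ℝ≥0∞, C ≠ 0 ∧ C ≠ ∞ ∧ ∀ (γ : «local» E c N J v) (p : standardParabolicGL (w.1.adicCompletion E) c')
      (hpM : (p : GL (Fin N) (w.1.adicCompletion E)) ∈ standardLeviGL (w.1.adicCompletion E) c')
      (_ : localSplitEquiv c J hc hJ w hw hJw γ = (p : GL (Fin N) (w.1.adicCompletion E)))
      (hpT : ∀ t ∈ T', t * (p : GL (Fin N) (w.1.adicCompletion E)) = (p : GL (Fin N) (w.1.adicCompletion E)) * t)
      (hTγ : ∀ g : «local» E c N J v, (localSplitEquiv c J hc hJ w hw hJw).toMulEquiv g ∈ T' ↔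
        g ∈ Subgroup.centralizer ({γ} : Set («local» E c N J v)))
      (_ : (1 - Matrix.of fun q q' : {i : Fin N // c' i = false} × {j : Fin N // c' j = true} =>
          ((p : GL (Fin N) (w.1.adicCompletion E)) : Matrix (Fin N) (Fin N) (w.1.adicCompletion E)) q.1 q'.1 *
            (((p⁻¹ : standardParabolicGL (w.1.adicCompletion E) c') : GL (Fin N) (w.1.adicCompletion E)) :
              Matrix (Fin N) (Fin N) (w.1.adicCompletion E)) q'.2 q.2).det ≠ 0)
      [MeasurableSpace (↥(«local» E c N J v) ⧸ Subgroup.centralizer ({γ} : Set («local» E c N J v)))]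
      [BorelSpace (↥(«local» E c N J v) ⧸ Subgroup.centralizer ({γ} : Set («local» E c N J v)))]
      (hC : IsClosed ((Subgroup.centralizer ({γ} : Set («local» E c N J v)) : Subgroup («local» E c N J v)) :
        Set («local» E c N J v)))
      (ρ : Measure (Subgroup.centralizer ({γ} : Set («local» E c N J v)))) [ρ.IsMulLeftInvariant]
      [IsFiniteMeasureOnCompacts ρ] [ρ.IsOpenPosMeasure] [ρ.IsInvInvariant] [SFinite ρ]
      (_ : ρ' = Measure.map (subgroupCongrHomeomorph (localSplitEquiv c J hc hJ w hw hJw).toMulEquiv _ T' hTγ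
        (localSplitEquiv c J hc hJ w hw hJw).continuous (localSplitEquiv c J hc hJ w hw hJw).symm.continuous) ρ)
      (ν : Measure («local» E c N J v)) [IsHaarMeasure ν] [ν.IsMulRightInvariant]
      (_ : ν (localIntegralLevel c N J v) = 1),
      ∫⁻ y, descConj γ (Subgroup.centralizer ({γ} : Set («local» E c N J v)))
          (fun _ hg => Subgroup.mem_centralizer_singleton_iff.1 hg)
          ((localIntegralLevel c N J v : Set («local» E c N J v)).indicator 1) y
          ∂quotientMeasure (Subgroup.centralizer ({γ} : Set («local» E c N J v))) ρ hC ν =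
        C * ((normAbs (w.1.adicCompletion E) ((1 - Matrix.of
              fun q q' : {i : Fin N // c' i = false} × {j : Fin N // c' j = true} =>
                ((p : GL (Fin N) (w.1.adicCompletion E)) : Matrix (Fin N) (Fin N) (w.1.adicCompletion E)) q.1 q'.1 *
                  (((p⁻¹ : standardParabolicGL (w.1.adicCompletion E) c') : GL (Fin N) (w.1.adicCompletion E)) :
                    Matrix (Fin N) (Fin N) (w.1.adicCompletion E)) q'.2 q.2).det)⁻¹ *
            normAbs (w.1.adicCompletion E) (Matrix.of
              fun q q' : {i : Fin N // c' i = false} × {j : Fin N // c' j = true} =>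
                ((p : GL (Fin N) (w.1.adicCompletion E)) : Matrix (Fin N) (Fin N) (w.1.adicCompletion E)) q.1 q'.1 *
                  (((p⁻¹ : standardParabolicGL (w.1.adicCompletion E) c') : GL (Fin N) (w.1.adicCompletion E)) :
                    Matrix (Fin N) (Fin N) (w.1.adicCompletion E)) q'.2 q.2).det : ℝ≥0) : ℝ≥0∞) *
          (κ univ * μU {u | (u : GL (Fin N) (w.1.adicCompletion E)) ∈ glInt N (w.1.adicCompletion E)}) *
          ∫⁻ z, descConj (⟨(p : GL (Fin N) (w.1.adicCompletion E)), hpM⟩ : ↥(standardLeviGL (w.1.adicCompletion E) c'))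
              (T'.subgroupOf (standardLeviGL (w.1.adicCompletion E) c'))
              (fun t ht => Subtype.ext (hpT (t : GL (Fin N) (w.1.adicCompletion E)) ht))
              (fun m : ↥(standardLeviGL (w.1.adicCompletion E) c') =>
                (glInt N (w.1.adicCompletion E) : Set (GL (Fin N) (w.1.adicCompletion E))).indicator 1
                  (m : GL (Fin N) (w.1.adicCompletion E)))
              z ∂μMT := by
  haveI : IsClosed ((T' : Subgroup (GL (Fin N) (w.1.adicCompletion E))) : Set (GL (Fin N) (w.1.adicCompletion E))) := hT'
  haveI : IsClosed ((standardLeviGL (w.1.adicCompletion E) c' : Subgroup (GL (Fin N) (w.1.adicCompletion E))) :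
      Set (GL (Fin N) (w.1.adicCompletion E))) := isClosed_standardLeviGL (R := w.1.adicCompletion E) c'
  haveI : BorelSpace ↥(unipotentRadicalGL (w.1.adicCompletion E) c') := Subtype.borelSpace _
  obtain ⟨C, hC0, hCt, h⟩ := exists_lintegral_descConj_eq_mul_lintegral_levi (w.1.adicCompletion E) hc'
    (M := standardLeviGL (w.1.adicCompletion E) c') rfl hT' hT'M (quotientMeasure T' ρ' hT' ν')
    (quotientMeasure_ne_zero T' ρ' hT' ν') μGM hGM μMT hMT κ μU
  refine ⟨C, hC0, hCt, ?_⟩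
  intro γ p hpM hγ hpT hTγ hp _ _ hCl ρ _ _ _ _ _ hρ ν _ _ hν
  have hν'e : ν' = ν.map (localSplitEquiv c J hc hJ w hw hJw) :=
    (map_localSplitEquiv_eq c N J hc hJ w hw hJw hJi ν ν' hν hν').symm
  -- Step 1: transport the `U(J)(F_v)`-side integral to `GL_N(E_w) ⧸ T′`, reading `1_{K_v} = 1_{GL_N(𝒪_w)} ∘ e`
  have h1 := lintegral_descConj_quotientMeasure_eq_of_mulEquiv_of_eq (localSplitEquiv c J hc hJ w hw hJw).toMulEquiv
    (localSplitEquiv c J hc hJ w hw hJw).continuous (localSplitEquiv c J hc hJ w hw hJw).symm.continuous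
    (Subgroup.centralizer ({γ} : Set («local» E c N J v))) T' hTγ (hH := hCl) (hH' := hT') ρ ρ' ν ν' hρ hν'e hγ
    (fun _ hg => Subgroup.mem_centralizer_singleton_iff.1 hg) hpT
    ((glInt N (w.1.adicCompletion E) : Set (GL (Fin N) (w.1.adicCompletion E))).indicator 1)
  have hind : (glInt N (w.1.adicCompletion E) : Set (GL (Fin N) (w.1.adicCompletion E))).indicator
      (1 : GL (Fin N) (w.1.adicCompletion E) → ℝ≥0∞) ∘
      ⇑(localSplitEquiv c J hc hJ w hw hJw).toMulEquiv =
        (localIntegralLevel c N J v : Set («local» E c N J v)).indicator 1 := by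
    have h2 := indicator_glInt_comp_localSplitEquiv c N J hc hJ w hw hJw hJi (1 : GL (Fin N) (w.1.adicCompletion E) → ℝ≥0∞)
    exact h2
  rw [hind] at h1
  rw [← h1]
  -- Step 2: the GL-side descent of ★ D-S1c at `F = 1_{GL_N(𝒪_w)}`
  have hmeas : Measurable ((glInt N (w.1.adicCompletion E) : Set (GL (Fin N) (w.1.adicCompletion E))).indicator
      (1 : GL (Fin N) (w.1.adicCompletion E) → ℝ≥0∞)) :=
    measurable_const.indicator (isOpen_glInt N (w.1.adicCompletion E)).measurableSet
  rw [h p hpM hpT hp _ hmeas]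
  -- Step 3: the constant term of `1_K` is `κ(K) μ_U(U(𝒪)) · 1_{K_M}` (§1)
  have hinner : (fun m : ↥(standardLeviGL (w.1.adicCompletion E) c') =>
      ∫⁻ q : ↥(glInt N (w.1.adicCompletion E)) × ↥(unipotentRadicalGL (w.1.adicCompletion E) c'),
        (glInt N (w.1.adicCompletion E) : Set (GL (Fin N) (w.1.adicCompletion E))).indicator 1
          ((q.1 : GL (Fin N) (w.1.adicCompletion E)) * ((m : GL (Fin N) (w.1.adicCompletion E)) *
            (q.2 : GL (Fin N) (w.1.adicCompletion E))) * (q.1 : GL (Fin N) (w.1.adicCompletion E))⁻¹) ∂(κ.prod μU)) =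
      fun m : ↥(standardLeviGL (w.1.adicCompletion E) c') =>
        (κ univ * μU {u | (u : GL (Fin N) (w.1.adicCompletion E)) ∈ glInt N (w.1.adicCompletion E)}) *
        (glInt N (w.1.adicCompletion E) : Set (GL (Fin N) (w.1.adicCompletion E))).indicator 1
          (m : GL (Fin N) (w.1.adicCompletion E)) :=
    funext fun m => lintegral_prod_indicator_glInt_conj_levi_mul κ μU m.2
  rw [hinner]
  -- Step 4: pull the constant `κ(K) μ_U(U(𝒪))` out of the `M`-side orbital integrand
  have hcomp : (fun m : ↥(standardLeviGL (w.1.adicCompletion E) c') =>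
      (κ univ * μU {u | (u : GL (Fin N) (w.1.adicCompletion E)) ∈ glInt N (w.1.adicCompletion E)}) *
        (glInt N (w.1.adicCompletion E) : Set (GL (Fin N) (w.1.adicCompletion E))).indicator 1
          (m : GL (Fin N) (w.1.adicCompletion E))) =
      (fun x : ℝ≥0∞ => (κ univ * μU {u | (u : GL (Fin N) (w.1.adicCompletion E)) ∈ glInt N (w.1.adicCompletion E)}) * x) ∘
        (fun m : ↥(standardLeviGL (w.1.adicCompletion E) c') =>
          (glInt N (w.1.adicCompletion E) : Set (GL (Fin N) (w.1.adicCompletion E))).indicator 1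
            (m : GL (Fin N) (w.1.adicCompletion E))) := rfl
  have hg : Measurable (fun m : ↥(standardLeviGL (w.1.adicCompletion E) c') =>
      (glInt N (w.1.adicCompletion E) : Set (GL (Fin N) (w.1.adicCompletion E))).indicator
        (1 : GL (Fin N) (w.1.adicCompletion E) → ℝ≥0∞) (m : GL (Fin N) (w.1.adicCompletion E))) :=
    hmeas.comp measurable_subtype_coe
  rw [hcomp, descConj_comp]
  simp only [Function.comp_def]
  rw [lintegral_const_mul _ (measurable_descConj _ _ _ hg)]
  ring

end Split

end Literature.NumberTheory.Rogawski1990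

end
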